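import Literature.Computability.AlgebraicComplexity.TableauEvalLabelMajorSymm
import HarnessLib

/-!
# Slicing a label step of the symmetrised label-major programme along its INPUT layer

Glue file (cell `val-lit`, DIP20 lane, unit val-lit-t05 g7; honest framing below) for the kernel
certificates of Dörfler–Ikenmeyer–Panova 2020, Prop. 5.1, `Ch_4^7` half
(`DIP20Prop51Certificates47*.lean`; engine `TableauEval.evalTS` of `TableauEvalLabelMajorSymm.lean`,
val-lit-t07 g4, on val-lit-t15 g4's `evalT` / `checkTable`). No statement about representations, no
definition, no named fact: theorems only.

A certificate is replayed in the kernel label by label (`layersS`), one `decide +kernel` per chunk of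
labels, the chunks glued through literal intermediate layers (`evalTS_eq_layerSum_split`,
`layersS_append`). The binding constraint of that protocol is the cost of ONE label (`stepS`): a label
whose expansion needs more transitions than one kernel call affords (the «fat label» of the residue rows,
10⁵–10⁶ transitions) cannot be cut at a label boundary. It CAN be cut along its input layer: the meaning
of a layer, `layerSpec S cols u n L = ∑_{e ∈ L} (value e) · specL S [u, …) (resid cols (state e) u)`
(`TableauEvalLabelMajorImpl` §4), is LINEAR in the list `L`; one symmetrised step preserves it
(`layerSpec_stepS`); and the re-sorting / merging `compressA ∘ msortK` preserves it (`sum_compressA`,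
`msortK_perm`). Hence (**`layerSum_layersS_slices`**): if `L = L₁ ++ ⋯ ++ Lₘ`,
`stepS cols V T u Lᵢ = Mᵢ` for every `i` (each an independent kernel computation whose cost is the
slice's share of the label's transitions) and `compressA (msortK d (M₁ ++ ⋯ ++ Mₘ)) = M` (cheap), then
`layerSum (layersS cols V T [u, u+1, …, u+k] L) = layerSum (layersS cols V T [u+1, …, u+k] M)`, so the
chunk chain continues from `M` after the fat label. **`layerSum_layersS_slices_tableTrie`** is the same
statement for the table trie of a network (the form in which certificate files use it, next to
`evalTS_eq_layerSum_split`). The only hypotheses are the network's column-strictness and the lengths of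
the states of the literal layers `L` and `M` (decidable on literals). A single state of a `V = 4` network
with seven boxes per label expands to at most `4⁷` outcomes, so slices can always be made as thin as one
kernel call requires.

Contents: §1 linearity of `layerSpec` in the layer (`layerSpec_append`, `layerSpec_flatten`,
`layerSpec_compressA_msortK`); §2 the slicing theorems; §2b hierarchical merging (`layerSpec_merge_node`,
`layerSpec_merge_level`, `layerSum_layersS_slices_spec`, `layerSum_layersS_slices_spec_tableTrie`: the merge hypothesis in
meaning, for a tree of kernel merges when one merge is too large); §3 a kernel sanity value (the toy network of
`TableauEvalLabelMajorSymm` §6, label `1` sliced in two).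

HONEST FRAMING: certificate-checking plumbing for DIP's TOY MODEL `Pow ⊄ Ch` (Chow variety versus power
sums, the separation `(per₃, det₄)`-style method validation of the cell); nothing here bears on permanent
versus determinant; VP ≠ VNP is not proved.

## References
* [DorflerIkenmeyerPanova2020] J. Dörfler, C. Ikenmeyer, G. Panova, *On geometric complexity theory:
  multiplicity obstructions are stronger than occurrence obstructions*, SIAM J. Appl. Algebra Geom. 4
  (2020) = arXiv:1901.04576, §5 (proof of Prop. 5.1 = Prop. 18 of the e-print: the proper-placement sum
  and its transfer-matrix organisation, arXiv pp. 12–13).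

## Mathlib and tree
Mathlib: `List.Forall₂`, `List.flatten`, `List.Perm.sum_eq`, `List.map_append`, `List.sum_append`.
Tree: `layerSpec`, `sum_compressA`, `msortK_perm`, `pairwise_of_columnStrict`
(`TableauEvalLabelMajorImpl`); `stepS`, `layersS`, `layerSpec_stepS`, `layerSum_layersS`,
`find_tableTrie_perm`, `evalTS`, `evalTS_eq_layerSum_split` (`TableauEvalLabelMajorSymm`); `compressA`,
`msortK`, `layerSum`, `PTrie`, `Network` (`TableauEvalLabelMajor`); `tableTrie`
(`ChowPointLabelMajorCertificates`).
-/

namespace Literature.Computability.AlgebraicComplexity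

namespace TableauEval

/-! ## §1 The meaning of a layer is linear in the layer -/

section Linear

variable {R : Type*} [CommRing R]

/-- `layerSpec` of a concatenation is the sum. [cite: DorflerIkenmeyerPanova2020, §5 (proof of Prop. 5.1, arXiv pp. 12–13)] -/
theorem layerSpec_append (S : List ℕ → R) (cols : List Column) (u n : ℕ)
    (X Y : List (ℕ × List (List ℕ) × R)) :
    layerSpec S cols u n (X ++ Y) = layerSpec S cols u n X + layerSpec S cols u n Y := by
  unfold layerSpec
  rw [List.map_append, List.sum_append]

/-- `layerSpec` of a concatenation of slices is the sum over the slices. [cite: DorflerIkenmeyerPanova2020, §5 (proof of Prop. 5.1, arXiv pp. 12–13)] -/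
theorem layerSpec_flatten (S : List ℕ → R) (cols : List Column) (u n : ℕ) :
    ∀ Ls : List (List (ℕ × List (List ℕ) × R)),
      layerSpec S cols u n Ls.flatten = (Ls.map (layerSpec S cols u n)).sum
  | [] => by simp [layerSpec]
  | L :: Ls => by
    rw [List.flatten_cons, layerSpec_append, layerSpec_flatten S cols u n Ls, List.map_cons, List.sum_cons]

/-- Re-sorting and merging a layer (`compressA ∘ msortK`, the tail of `stepS`, with any fuel) does not
change its meaning. [cite: DorflerIkenmeyerPanova2020, §5 (proof of Prop. 5.1, arXiv pp. 12–13)] -/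
theorem layerSpec_compressA_msortK (S : List ℕ → R) (cols : List Column) (u n d : ℕ)
    (X : List (ℕ × List (List ℕ) × R)) :
    layerSpec S cols u n (compressA (msortK d X)) = layerSpec S cols u n X := by
  unfold layerSpec
  rw [sum_compressA (fun st => specL S (List.range' u n) (resid cols st u)) (msortK d X)]
  exact ((msortK_perm d X).map _).sum_eq

/-- Slice by slice, one symmetrised step preserves the meaning. [cite: DorflerIkenmeyerPanova2020, §5 (proof of Prop. 5.1, arXiv pp. 12–13)] -/
theorem map_layerSpec_of_forall₂_stepS (V : ℕ) (T : PTrie R)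
    (hT : ∀ w w' : List ℕ, w.Perm w' → T.find w = T.find w')
    (cols : List Column) (hcs : ∀ c ∈ cols, c.labels.Pairwise (· < ·)) (u k : ℕ) :
    ∀ {Ls Ms : List (List (ℕ × List (List ℕ) × R))},
      List.Forall₂ (fun Li Mi => stepS cols V T u Li = Mi) Ls Ms →
      (∀ Li ∈ Ls, ∀ e ∈ Li, e.2.1.length = cols.length) →
      Ls.map (layerSpec (fun w => T.find w) cols u (k + 1)) =
        Ms.map (layerSpec (fun w => T.find w) cols (u + 1) k)
  | _, _, List.Forall₂.nil, _ => rfl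
  | _, _, List.Forall₂.cons (a := Li) (b := Mi) (l₁ := Ls) (l₂ := Ms) h hrest, hlen => by
    rw [List.map_cons, List.map_cons, ← h,
      layerSpec_stepS V T hT cols hcs u k Li (hlen Li List.mem_cons_self),
      map_layerSpec_of_forall₂_stepS V T hT cols hcs u k hrest
        (fun L hL => hlen L (List.mem_cons_of_mem _ hL))]

end Linear

/-! ## §2 Slicing a label along its input layer -/

section Slicing

variable {R : Type*} [CommRing R]

/-- **Input-layer slicing of one label.** If the layer `L` before label `u` is the concatenation of
the slices `Ls`, every slice `Lᵢ` steps to `Mᵢ` (`stepS cols V T u Lᵢ = Mᵢ`, one kernel computation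
each), and the concatenated outputs re-sort and merge to `M`, then running the labels `u, …, u + k`
from `L` and running the labels `u + 1, …, u + k` from `M` give the same total — for a content-blind
entry trie and columns with increasing label lists, the hypotheses of `layerSum_layersS`.
[cite: DorflerIkenmeyerPanova2020, §5 (proof of Prop. 5.1, arXiv pp. 12–13)] -/
theorem layerSum_layersS_slices (V : ℕ) (T : PTrie R)
    (hT : ∀ w w' : List ℕ, w.Perm w' → T.find w = T.find w')
    (cols : List Column) (hcs : ∀ c ∈ cols, c.labels.Pairwise (· < ·)) (u k : ℕ)
    (L M : List (ℕ × List (List ℕ) × R)) (Ls Ms : List (List (ℕ × List (List ℕ) × R)))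
    (hL : Ls.flatten = L)
    (hsteps : List.Forall₂ (fun Li Mi => stepS cols V T u Li = Mi) Ls Ms)
    (d : ℕ) (hM : compressA (msortK d Ms.flatten) = M)
    (hlenL : ∀ e ∈ L, e.2.1.length = cols.length) (hlenM : ∀ e ∈ M, e.2.1.length = cols.length) :
    layerSum (layersS cols V T (List.range' u (k + 1)) L) =
      layerSum (layersS cols V T (List.range' (u + 1) k) M) := by
  have hlenLs : ∀ Li ∈ Ls, ∀ e ∈ Li, e.2.1.length = cols.length :=
    fun Li hLi e he => hlenL e (hL ▸ List.mem_flatten.mpr ⟨Li, hLi, he⟩)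
  rw [layerSum_layersS V T hT cols hcs (k + 1) u L hlenL, layerSum_layersS V T hT cols hcs k (u + 1) M hlenM,
    ← hM, layerSpec_compressA_msortK, ← hL, layerSpec_flatten, layerSpec_flatten,
    map_layerSpec_of_forall₂_stepS V T hT cols hcs u k hsteps hlenLs]

/-- **Input-layer slicing of one label, for the table trie of a column-strict network** — the form used
next to `evalTS_eq_layerSum_split` / `layersS_append` in certificate files: the slice equalities
`stepS Nw.cols Nw.varBound (tableTrie …) u Lᵢ = Mᵢ` and the merge equality are kernel computations, the
length hypotheses are decided on the literal layers. [cite: DorflerIkenmeyerPanova2020, §5 (proof of Prop. 5.1, arXiv pp. 12–13)] -/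
theorem layerSum_layersS_slices_tableTrie [DecidableEq R] (tab : List (List ℕ × R)) (Nw : Network)
    (hcs : Nw.columnStrict = true) (u k : ℕ)
    (L M : List (ℕ × List (List ℕ) × R)) (Ls Ms : List (List (ℕ × List (List ℕ) × R)))
    (hL : Ls.flatten = L)
    (hsteps : List.Forall₂
      (fun Li Mi => stepS Nw.cols Nw.varBound (tableTrie Nw.varBound tab Nw.perLabel []) u Li = Mi) Ls Ms)
    (d : ℕ) (hM : compressA (msortK d Ms.flatten) = M)
    (hlenL : ∀ e ∈ L, e.2.1.length = Nw.cols.length) (hlenM : ∀ e ∈ M, e.2.1.length = Nw.cols.length) :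
    layerSum (layersS Nw.cols Nw.varBound (tableTrie Nw.varBound tab Nw.perLabel [])
        (List.range' u (k + 1)) L) =
      layerSum (layersS Nw.cols Nw.varBound (tableTrie Nw.varBound tab Nw.perLabel [])
        (List.range' (u + 1) k) M) :=
  layerSum_layersS_slices Nw.varBound _ (fun _ _ h => find_tableTrie_perm _ _ _ h) Nw.cols
    (pairwise_of_columnStrict Nw hcs) u k L M Ls Ms hL hsteps d hM hlenL hlenM

/-- **The whole evaluation through one sliced label**: `evalTS` split at label `u` (the labels `< u`
run from the initial layer to `L`), label `u` sliced as above, the labels `> u` run from `M`.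
[cite: DorflerIkenmeyerPanova2020, §5 (proof of Prop. 5.1, arXiv pp. 12–13)] -/
theorem evalTS_eq_layerSum_of_slices [DecidableEq R] (tab : List (List ℕ × R)) (Nw : Network)
    (hcs : Nw.columnStrict = true) (u : ℕ) (hu : u + 1 ≤ Nw.nlabels)
    (L M : List (ℕ × List (List ℕ) × R)) (Ls Ms : List (List (ℕ × List (List ℕ) × R)))
    (hpre : layersS Nw.cols Nw.varBound (tableTrie Nw.varBound tab Nw.perLabel [])
      (List.range' 0 u) Nw.initLayer = L)
    (hL : Ls.flatten = L)
    (hsteps : List.Forall₂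
      (fun Li Mi => stepS Nw.cols Nw.varBound (tableTrie Nw.varBound tab Nw.perLabel []) u Li = Mi) Ls Ms)
    (d : ℕ) (hM : compressA (msortK d Ms.flatten) = M)
    (hlenL : ∀ e ∈ L, e.2.1.length = Nw.cols.length) (hlenM : ∀ e ∈ M, e.2.1.length = Nw.cols.length) :
    evalTS tab Nw =
      layerSum (layersS Nw.cols Nw.varBound (tableTrie Nw.varBound tab Nw.perLabel [])
        (List.range' (u + 1) (Nw.nlabels - (u + 1))) M) := by
  rw [evalTS_eq_layerSum_split tab Nw u (by omega), hpre,
    show Nw.nlabels - u = (Nw.nlabels - (u + 1)) + 1 by omega]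
  exact layerSum_layersS_slices_tableTrie tab Nw hcs u _ L M Ls Ms hL hsteps d hM hlenL hlenM

end Slicing

/-! ## §2b Hierarchical merging of the slice outputs

When a sliced label has many slices and a large output layer, the single merge
`compressA (msortK d (M₁ ++ ⋯ ++ Mₘ)) = M` is itself too big for one kernel call. It can be done as a
TREE of merges, each node a kernel equality `compressA (msortK d (children).flatten) = node`; the glue
then only needs the MEANING of the merge, `∑ᵢ layerSpec Mᵢ = layerSpec M`, which the node equalities
give by `layerSpec_merge_node` and ring arithmetic. -/

section Merge

variable {R : Type*} [CommRing R]

/-- **One merge node**: a kernel equality `compressA (msortK d Ms.flatten) = M` says, in meaning, that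
`layerSpec M` is the sum of the `layerSpec` of the merged pieces. [cite: DorflerIkenmeyerPanova2020, §5 (proof of Prop. 5.1, arXiv pp. 12–13)] -/
theorem layerSpec_merge_node (S : List ℕ → R) (cols : List Column) (u n d : ℕ)
    (Ms : List (List (ℕ × List (List ℕ) × R))) (M : List (ℕ × List (List ℕ) × R))
    (h : compressA (msortK d Ms.flatten) = M) :
    layerSpec S cols u n M = (Ms.map (layerSpec S cols u n)).sum := by
  rw [← h, layerSpec_compressA_msortK, layerSpec_flatten]

/-- **Input-layer slicing of one label, merge given in meaning**: as `layerSum_layersS_slices`, with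
the merge hypothesis replaced by `∑ᵢ layerSpec Mᵢ = layerSpec M` (obtained from a tree of
`layerSpec_merge_node`s). [cite: DorflerIkenmeyerPanova2020, §5 (proof of Prop. 5.1, arXiv pp. 12–13)] -/
theorem layerSum_layersS_slices_spec (V : ℕ) (T : PTrie R)
    (hT : ∀ w w' : List ℕ, w.Perm w' → T.find w = T.find w')
    (cols : List Column) (hcs : ∀ c ∈ cols, c.labels.Pairwise (· < ·)) (u k : ℕ)
    (L M : List (ℕ × List (List ℕ) × R)) (Ls Ms : List (List (ℕ × List (List ℕ) × R)))
    (hL : Ls.flatten = L)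
    (hsteps : List.Forall₂ (fun Li Mi => stepS cols V T u Li = Mi) Ls Ms)
    (hM : (Ms.map (layerSpec (fun w => T.find w) cols (u + 1) k)).sum =
      layerSpec (fun w => T.find w) cols (u + 1) k M)
    (hlenL : ∀ e ∈ L, e.2.1.length = cols.length) (hlenM : ∀ e ∈ M, e.2.1.length = cols.length) :
    layerSum (layersS cols V T (List.range' u (k + 1)) L) =
      layerSum (layersS cols V T (List.range' (u + 1) k) M) := by
  have hlenLs : ∀ Li ∈ Ls, ∀ e ∈ Li, e.2.1.length = cols.length :=
    fun Li hLi e he => hlenL e (hL ▸ List.mem_flatten.mpr ⟨Li, hLi, he⟩)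
  rw [layerSum_layersS V T hT cols hcs (k + 1) u L hlenL, layerSum_layersS V T hT cols hcs k (u + 1) M hlenM,
    ← hM, ← hL, layerSpec_flatten, map_layerSpec_of_forall₂_stepS V T hT cols hcs u k hsteps hlenLs]

/-- **Input-layer slicing of one label, merge given in meaning, for the table trie of a column-strict
network** (the certificate-file form). [cite: DorflerIkenmeyerPanova2020, §5 (proof of Prop. 5.1, arXiv pp. 12–13)] -/
theorem layerSum_layersS_slices_spec_tableTrie [DecidableEq R] (tab : List (List ℕ × R)) (Nw : Network)
    (hcs : Nw.columnStrict = true) (u k : ℕ)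
    (L M : List (ℕ × List (List ℕ) × R)) (Ls Ms : List (List (ℕ × List (List ℕ) × R)))
    (hL : Ls.flatten = L)
    (hsteps : List.Forall₂
      (fun Li Mi => stepS Nw.cols Nw.varBound (tableTrie Nw.varBound tab Nw.perLabel []) u Li = Mi) Ls Ms)
    (hM : (Ms.map (layerSpec (fun w => (tableTrie Nw.varBound tab Nw.perLabel []).find w) Nw.cols (u + 1) k)).sum =
      layerSpec (fun w => (tableTrie Nw.varBound tab Nw.perLabel []).find w) Nw.cols (u + 1) k M)
    (hlenL : ∀ e ∈ L, e.2.1.length = Nw.cols.length) (hlenM : ∀ e ∈ M, e.2.1.length = Nw.cols.length) :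
    layerSum (layersS Nw.cols Nw.varBound (tableTrie Nw.varBound tab Nw.perLabel [])
        (List.range' u (k + 1)) L) =
      layerSum (layersS Nw.cols Nw.varBound (tableTrie Nw.varBound tab Nw.perLabel [])
        (List.range' (u + 1) k) M) :=
  layerSum_layersS_slices_spec Nw.varBound _ (fun _ _ h => find_tableTrie_perm _ _ _ h) Nw.cols
    (pairwise_of_columnStrict Nw hcs) u k L M Ls Ms hL hsteps hM hlenL hlenM

/-- **One level of a merge tree**: if every group `Msⱼ` of layers merges (in the kernel) to the node `Nⱼ`,
the `layerSpec` over all grouped layers add up to the `layerSpec` over the nodes. Chained level by level and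
closed by `layerSpec_merge_node` at the root, this gives the merge hypothesis of
`layerSum_layersS_slices_spec` as a plain term (no rewriting inside the heavy literal layers).
[cite: DorflerIkenmeyerPanova2020, §5 (proof of Prop. 5.1, arXiv pp. 12–13)] -/
theorem layerSpec_merge_level (S : List ℕ → R) (cols : List Column) (u n d : ℕ) :
    ∀ {Mss : List (List (List (ℕ × List (List ℕ) × R)))} {Ns : List (List (ℕ × List (List ℕ) × R))},
      List.Forall₂ (fun Ms N => compressA (msortK d Ms.flatten) = N) Mss Ns →
      (Mss.flatten.map (layerSpec S cols u n)).sum = (Ns.map (layerSpec S cols u n)).sum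
  | _, _, List.Forall₂.nil => rfl
  | _, _, List.Forall₂.cons (a := Ms) (b := N) h hrest => by
    rw [List.flatten_cons, List.map_append, List.sum_append, List.map_cons, List.sum_cons,
      layerSpec_merge_node S cols u n d Ms N h, layerSpec_merge_level S cols u n d hrest]

end Merge


/-! ## §3 Sanity value (kernel) -/

/-- The `(10,6,6,6)` residue row of `TableauEvalLabelMajorSymm` §6 (`d = 4`, six equal full columns, the
sparse integer Chow point `x · x · z · w · (2w - x) · (2y + 2z) · (y - z)`, value `91729428480`): the
layer before label `2` has `37` states; label `2` SLICED into the first `20` and the last `17` states,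
the two outputs re-sorted and merged, IS the unsliced layer after label `2` (`8` states), and label `3`
run from it returns the value. [folklore] -/
example :
    let N : Network := ⟨4, 7, [⟨[0, 1, 2, 3], [0, 1, 2, 3]⟩, ⟨[0, 1, 2, 3], [0, 1, 2, 3]⟩,
      ⟨[0, 1, 2, 3], [0, 1, 2, 3]⟩, ⟨[0, 1, 2, 3], [0, 1, 2, 3]⟩, ⟨[0, 1, 2, 3], [0, 1, 2, 3]⟩,
      ⟨[0, 1, 2, 3], [0, 1, 2, 3]⟩, ⟨[0], [0]⟩, ⟨[0], [1]⟩, ⟨[0], [2]⟩, ⟨[0], [3]⟩]⟩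
    let tab : List (List ℕ × ℤ) :=
      [([2, 0, 3, 2], -96), ([2, 2, 1, 2], 32), ([3, 0, 3, 1], 72), ([3, 2, 1, 1], -24)]
    let T := tableTrie N.varBound tab N.perLabel []
    let L := layersS N.cols N.varBound T (List.range' 0 2) N.initLayer
    let M := compressA (msortK 12
      (stepS N.cols N.varBound T 2 (L.take 20) ++ stepS N.cols N.varBound T 2 (L.drop 20)))
    L.length = 37 ∧ M = stepS N.cols N.varBound T 2 L ∧ M.length = 8 ∧
      layerSum (layersS N.cols N.varBound T (List.range' 3 1) M) = 91729428480 := by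
  decide +kernel

end TableauEval

end Literature.Computability.AlgebraicComplexity
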